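import Summits.BirchSwinnertonDyer.BirchSwinnertonDyer.Theses.ByReductionTypeAtTwo
import Summits.BirchSwinnertonDyer.BirchSwinnertonDyer.Theses.GenusKolyvaginAtTwo
import Summits.BirchSwinnertonDyer.BirchSwinnertonDyer.Theorems.ByReductionTypeAtTwoRankOneAtTwoOneDoorLawDefs
import Summits.BirchSwinnertonDyer.BirchSwinnertonDyer.Theorems.CMKolyvaginAtInertTwoCMExactDescentAtTwoGeneral
import Summits.BirchSwinnertonDyer.BirchSwinnertonDyer.Theorems.RamifiedHeegnerPairRamifiedPairUpperBoundOfUpperHalfOverK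
import HarnessLib

/-!
# Route ByReductionTypeAtTwo, crux `RankOneAtTwoBigImageOddLocal` (stmt-BirchSwinnertonDyer-23715):
# the K-SIDE BRIDGE — the crux from route GenusKolyvaginAtTwo's crux `KolyvaginExactAtTwo` BY NAME

Width prover seat `bsd-line-fkl-p2` g7 (2026-08-28), `--supports stmt-BirchSwinnertonDyer-23715`.  THEOREMS ONLY; nothing
asserted; BSD is not proved by any of this.

The line of record `one_door_analytic` (v8.2) hangs the crux on ONE E-side conjecture, `DoorIndexLawFullAtTwo` (AN-28: the exact
`2`-divisibility exponent of the Heegner point against `#Ш(E)[2^∞]·#Ш(E^{(d)})[2^∞]` and the door-prime counts `t, s`), whose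
line card names as its K-side relative the crux `KolyvaginExactAtTwo` of route GenusKolyvaginAtTwo (stmt-BirchSwinnertonDyer-22137,
split 24880–24883: Kolyvagin EXACTNESS `#Ш(E/K)[2^∞] = 4^{M₀}` from a `2`-indivisible derived point `P(n)`, McCallum's structure
theorem at `p = 2`) — «one proof of 2-exactness over K serves both routes».  This file makes that sharing a kernel implication.
The tree already holds the CM-free, rank-order-symmetric exact descent of the sibling cell
(`CMExactDescent.bsdp_two_of_card_sha_baseChange_eq_of_facts_rankOne`, `…CMExactDescentAtTwoGeneral.lean`, p582452: for the
RANK-ONE member `W` — `ρ̄_{W,2}` onto, odd `∏ c_ℓ`, odd Manin constant, `K` with odd `d_K ≠ −3` and the Heegner hypothesis,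
`y_K` of infinite order with `2^{M₀} ∥ y_K`, `#Ш(E_K)[2^∞] = 4^{M₀}`, and `BSD(Wd, 2)` for a minimal model of the twin ⟹
`BSD(W, 2)`, modulo Gross–Zagier, GZK, modularity and Milne 1972 any-model).  Composing it with `KolyvaginExactAtTwo` and with
rank-`0` `BSD₂` of the twin (the reduction-type-free `S_rankZeroTwin`, i.e. route ByReductionTypeAtTwo's OWN four rank-`0` cruxes,
`rankZeroTwin_of_rankZero_cruxes`) gives:

* `bsdp_two_of_kolyvaginExactAtTwo_at` — PER DATUM: for `W` on the slice of 23715 (non-CM, `ρ_{W,2^n}` onto for all `n`, odd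
  `∏ c_ℓ`, `r_an = 1`; the odd-TORSION hypothesis of the crux is NOT needed), a Kolyvagin-admissible Heegner field `K` (odd
  `d_K ≠ −3`, Heegner hypothesis, `d_K·(−|Δ|)` and `d_K·(−2|Δ|)` non-squares), an odd-constant parametrisation datum with a
  conductor-`1` Kolyvagin–Heegner datum whose `y_K = P(1)` has infinite order and exact `2`-divisibility exponent `M₀`, and ANY
  square-free product `n` of Kolyvagin primes at `2` with `P(n) ∉ 2E(K[n])`:  `KolyvaginExactAtTwo → S_rankZeroTwin → BSD(W, 2)`
  modulo the four PRINT binders.  (`L(E^{(d_K)},1) ≠ 0` is OUTPUT here — from `y_K` non-torsion by Gross–Zagier — so the twin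
  has analytic rank `0` and `S_rankZeroTwin` applies to its minimal model, which is non-CM by `j`-invariance.)
* `rankOneAtTwoBigImageOddLocal_of_kolyvaginExactAtTwo` — the crux BY NAME from: PRINT (`gross_zagier`, GZK, `hasEntireLFunction_rat`,
  `Milne1972.bsdQuotient_baseChange_quadratic_anyModel`), `KolyvaginExactAtTwo` (route GenusKolyvaginAtTwo, BY NAME), `S_rankZeroTwin`,
  and ONE explicit SUPPLY binder on the slice (spelled out in the signature, the rank-`1` analogue of GenusKolyvaginAtTwo's
  `GenusPrimitiveSupplyAtTwo`): a Kolyvagin-admissible `K`, an odd-constant `Dt` (= the line's `S_manin`), a conductor-`1` datum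
  with `y_K` non-torsion and its `M₀` (theorem-grade: Hoffstein–Luo door + Gross–Zagier + finite generation), and a `2`-INDIVISIBLE
  DERIVED POINT `P(n)` (Kolyvagin's conjecture at `p = 2` for `(E, K)` — the one open clause of the supply; `n = 1` when `M₀ = 0`).
(The route's four rank-`0` cruxes BY NAME give `S_rankZeroTwin` through `rankZeroTwin_of_rankZero_cruxes` of
`…OneDoorAnalyticAssembly.lean`; not re-imported here to keep this module off that module's route cone.)

Net effect for the planner-of-record: on this bridge the cone of 23715 is {PRINT, crux 22137 of route GenusKolyvaginAtTwo,
Kolyvagin's conjecture at `2` on the slice's doors, Manin (inside the supply), the route's rank-`0` cruxes} — the E-side conjecture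
`DoorIndexLawFullAtTwo` is traded for the K-side crux that the sibling route is already attacking.  Nothing here is asserted.

References: [GrossZagier1986] V.§2; [GrossLMS1991] §2 (2.2), §4; [McCallumLMS1991] §5; [Kolyvagin1990] Thm. A;
[Milne1972ArithmeticAV] §1 Thm. 1; [Miller2011LMS] Def. 1.1; [WZhang2014] §3.7.
-/

set_option autoImplicit false
-- the Theorems namespace of this sub repeats the summit name by design (D-0017 nested layout)
set_option linter.dupNamespace false

noncomputable section

open scoped Classical

namespace Summit.BirchSwinnertonDyer.BirchSwinnertonDyer.Theorems.RankOneAtTwoOneDoor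

open WeierstrassCurve NumberField Literature.NumberTheory.EllipticCurves Literature.NumberTheory.EllipticCurves.ModularForms
  Literature.NumberTheory.EllipticCurves.Rank1Residual
  Literature.NumberTheory.EllipticCurves.Rank1Residual.Typed
  Literature.NumberTheory.EllipticCurves.KrizLi2019
  Summit.BirchSwinnertonDyer.Rank1Residual
  Summit.BirchSwinnertonDyer.Rank1Residual.AdditivePotMult
  Summit.BirchSwinnertonDyer.Rank1Residual.F1Sign2
  Summit.BirchSwinnertonDyer.BirchSwinnertonDyer.Theses.ByReductionTypeAtTwo
  Summit.BirchSwinnertonDyer.BirchSwinnertonDyer.Theses.GenusKolyvaginAtTwo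
  Summit.BirchSwinnertonDyer.BirchSwinnertonDyer.Theorems.CMExactDescent

/-! ### §1 Per datum: `BSD(W, 2)` on the slice from Kolyvagin exactness over `K` and rank-`0` `BSD₂` of the twin -/

/-- **`BSD(W, 2)` for the rank-one member from `KolyvaginExactAtTwo`, PER DATUM.**  `W/ℚ` globally minimal, non-CM, `ρ_{W,2^n}`
onto for every `n`, `∏_ℓ c_ℓ(W)` odd, `r_an(W) = 1`; `K` imaginary quadratic with odd `d_K ≠ −3`, the Heegner hypothesis for `N_W`,
`d_K·(−|Δ|)` and `d_K·(−2|Δ|)` non-squares; `Dt` a parametrisation datum with odd constant, `d₁` a conductor-`1` Kolyvagin–Heegner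
datum with `y_K = P(1)` of infinite order and `2^{M₀} ∥ P(1)` in `E(K[1])`; `n` square-free, every `ℓ ∣ n` a Kolyvagin prime at `2`,
`d` a conductor-`n` datum with `P(n) ∉ 2E(K[n])`.  THEN, modulo Gross–Zagier (`hGZ`), GZK (`hGZK`), modularity (`hmod`), Milne 1972
(`hMilneC`): `KolyvaginExactAtTwo` (`hX`, crux 22137 of route GenusKolyvaginAtTwo) and rank-`0` `BSD₂` of non-CM curves (`hZ`) give
`BSD(W, 2)`.  Proof: `hX` yields `#Ш(E_K)[2^∞] = 4^{M₀}`; `y_K` non-torsion gives `L'(E/K,1) ≠ 0` (Gross–Zagier), hence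
`L(E^{(d_K)},1) ≠ 0` and analytic rank `0` for the minimal model `Wd` of the twist, which is non-CM (`j`-invariance), so `hZ` gives
`BSD(Wd, 2)`; then `CMExactDescent.bsdp_two_of_card_sha_baseChange_eq_of_facts_rankOne`.
[cite: GrossZagier1986, V.§2 (pp. 310–312)] [cite: McCallumLMS1991, §5 Lemma 5.1] [cite: Milne1972ArithmeticAV, §1 Thm. 1] -/
theorem bsdp_two_of_kolyvaginExactAtTwo_at
    (hGZ : ∀ (N : ℕ) [NeZero N] (W : WeierstrassCurve ℚ) (K : Type) [Field K] [NumberField K], gross_zagier N W K)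
    (hGZK : rank_eq_analyticRank_of_analyticRank_le_one) (hmod : hasEntireLFunction_rat)
    (hMilneC : Milne1972.bsdQuotient_baseChange_quadratic_anyModel)
    (hX : KolyvaginExactAtTwo) (hZ : S_rankZeroTwin)
    (W : WeierstrassCurve ℚ) [W.IsElliptic] [W.IsGloballyMinimal] [NeZero (W.conductorNorm ℤ)]
    (hCM : ¬ W.HasCM) (hsurj : ∀ n : ℕ, W.HasSurjectiveModNGaloisRep ((2 ^ n : ℕ) : ℤ)) (hc : Odd W.tamagawaProduct)
    (hr : W.analyticRank = 1)
    (K : Type) [Field K] [NumberField K] (hK : IsImaginaryQuadratic K) (hodd : Odd (NumberField.discr K))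
    (h3 : NumberField.discr K ≠ -3) (hH : SatisfiesHeegnerHypothesis (W.conductorNorm ℤ) K)
    (hsq1 : ¬ IsSquare ((NumberField.discr K : ℚ) * -|W.Δ|))
    (hsq2 : ¬ IsSquare ((NumberField.discr K : ℚ) * (-(2 * |W.Δ|))))
    (Dt : ModularParametrizationData W (W.conductorNorm ℤ)) (hcM : Odd Dt.c) (β : ℤ) (ι : K →+* ℂ)
    (d₁ : KolyvaginHeegnerData Dt β ι 1) (hy : ¬ IsOfFinAddOrder d₁.derivedPoint) (M₀ : ℕ)
    (hdiv : ∃ Q : (W.baseChange (ringClassField K ι 1)).toAffine.Point, ((2 ^ M₀ : ℕ) : ℤ) • Q = d₁.derivedPoint)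
    (hndiv : ¬ ∃ Q : (W.baseChange (ringClassField K ι 1)).toAffine.Point,
      ((2 ^ (M₀ + 1) : ℕ) : ℤ) • Q = d₁.derivedPoint)
    (n : ℕ) (d : KolyvaginHeegnerData Dt β ι n) (hn : Squarefree n)
    (hKoly : ∀ ℓ ∈ n.primeFactors, Zhang2014.IsKolyvaginPrime (W.conductorNorm ℤ) W K 2 ℓ)
    (hPn : ¬ ∃ Q : (W.baseChange (ringClassField K ι n)).toAffine.Point, (2 : ℤ) • Q = d.derivedPoint) :
    BSDp W 2 := by
  have hρ : ∀ m : ℕ, 0 < m → W.HasSurjectiveModNGaloisRep ((2 : ℤ) ^ m) := fun m _ => by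
    have h := hsurj m
    push_cast at h
    exact h
  have hρ2 : W.HasSurjectiveModNGaloisRep 2 := by
    have h := hρ 1 one_pos
    rwa [pow_one] at h
  -- Kolyvagin exactness over `K` (route GenusKolyvaginAtTwo's crux, BY NAME)
  have hsha : Nat.card (AddCommGroup.primaryComponent (W.baseChange K).sha 2) = 2 ^ (2 * M₀) :=
    hX W hCM K hK hodd h3 hH hsq1 hsq2 hρ Dt β ι d₁ hy M₀ hdiv hndiv n d hn hKoly hPn
  -- the twin: a globally minimal model, non-CM, of analytic rank `0`; its `BSD₂` from the rank-`0` statement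
  have hD0 : (NumberField.discr K : ℚ) ≠ 0 := by exact_mod_cast NumberField.discr_ne_zero K
  haveI hEt : (W.quadraticTwist (NumberField.discr K : ℚ)).IsElliptic := W.isElliptic_quadraticTwist hD0
  obtain ⟨Cd, hCd⟩ := hasGlobalMinimalModel_rat_holds (W.quadraticTwist (NumberField.discr K : ℚ))
  haveI : (Cd • W.quadraticTwist (NumberField.discr K : ℚ)).IsGloballyMinimal := hCd
  have hCMd : ¬ (Cd • W.quadraticTwist (NumberField.discr K : ℚ)).HasCM :=
    RamifiedPairUpperBound.not_hasCM_of_smul_quadraticTwist_eq hD0 rfl hCM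
  -- `L(E^{(d_K)}, 1) ≠ 0` from the non-torsion of `y_K` (Gross–Zagier over `K`)
  obtain ⟨P₀, Hd, hP₀, hP₀K⟩ := exists_heegnerPoint_map_eq_derivedPoint_one hK hH d₁
  have hPinf : ¬ IsOfFinAddOrder P₀ := by
    intro hfin
    apply hy
    rw [← hP₀K]
    exact (WeierstrassCurve.Affine.Point.map (W' := W)
      (algebraMap K (ringClassField K ι 1)).toRatAlgHom).isOfFinAddOrder hfin
  have hLK : LDerivEK W K ≠ 0 :=
    (lDerivEK_ne_zero_iff_not_isOfFinAddOrder W (W.conductorNorm ℤ) K (hGZ _ W K) hK hH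
      ⟨Dt, Hd, ι, hP₀⟩).mpr hPinf
  have hL0 : W.entireLFunction 1 = 0 := entireLFunction_one_eq_zero_of_analyticRank_eq_one hr
  have hLt : (W.quadraticTwist (NumberField.discr K : ℚ)).entireLFunction 1 ≠ 0 := by
    intro h0
    apply hLK
    rw [lDerivEK_eq_deriv_mul W K hmod hL0, h0, mul_zero]
  have hrt : (W.quadraticTwist (NumberField.discr K : ℚ)).analyticRank = 0 :=
    ((W.quadraticTwist _).analyticRank_eq_zero_iff_holds (hmod _)).mpr hLt
  have hrd : (Cd • W.quadraticTwist (NumberField.discr K : ℚ)).analyticRank = 0 := by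
    rw [analyticRank_smul, hrt]
  have hBd : BSDp (Cd • W.quadraticTwist (NumberField.discr K : ℚ)) 2 := hZ _ hCMd hrd
  exact bsdp_two_of_card_sha_baseChange_eq_of_facts_rankOne W K Dt β ι d₁
    (Cd • W.quadraticTwist (NumberField.discr K : ℚ)) (hGZ _ W K) hGZK hmod hMilneC hρ2 hc hr hK hodd h3 hH hcM hy hdiv
    hndiv hsha ⟨Cd, rfl⟩ hBd

/-! ### §2 The crux BY NAME from `KolyvaginExactAtTwo`, a rank-one Kolyvagin supply, rank-`0` `BSD₂` and PRINT -/

/-- **Crux `RankOneAtTwoBigImageOddLocal` from route GenusKolyvaginAtTwo's `KolyvaginExactAtTwo` (BY NAME), PRINT, rank-`0`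
`BSD₂` of non-CM curves, and ONE rank-one Kolyvagin SUPPLY binder** (`hSup`, spelled out: for every `W` on the slice — non-CM,
`ρ_{W,2^n}` onto, odd torsion, odd `∏ c_ℓ`, `r_an = 1` — a Kolyvagin-admissible Heegner field `K` (odd `d_K ≠ −3`, Heegner
hypothesis, `d_K·(−|Δ|)`, `d_K·(−2|Δ|)` non-squares), an odd-constant parametrisation datum `Dt`, `β`, `ι`, a conductor-`1`
Kolyvagin–Heegner datum with `y_K` of infinite order and its exact `2`-divisibility exponent `M₀` in `E(K[1])`, and a square-free
product `n` of Kolyvagin primes at `2` with a conductor-`n` datum whose derived point `P(n) ∉ 2E(K[n])` — the last clause being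
Kolyvagin's conjecture at `p = 2` for `(E, K)`, the rest theorem-grade modulo Hoffstein–Luo / Gross–Zagier / Manin).  Pure
composition of `bsdp_two_of_kolyvaginExactAtTwo_at`.  BSD is not proved by this: conditional by design.
[cite: GrossLMS1991, §2 Conj. (2.2) and §4] [cite: McCallumLMS1991, §5] -/
theorem rankOneAtTwoBigImageOddLocal_of_kolyvaginExactAtTwo
    (hGZ : ∀ (N : ℕ) [NeZero N] (W : WeierstrassCurve ℚ) (K : Type) [Field K] [NumberField K], gross_zagier N W K)
    (hGZK : rank_eq_analyticRank_of_analyticRank_le_one) (hmod : hasEntireLFunction_rat)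
    (hMilneC : Milne1972.bsdQuotient_baseChange_quadratic_anyModel)
    (hX : KolyvaginExactAtTwo)
    (hSup : ∀ (W : WeierstrassCurve ℚ) [W.IsElliptic] [W.IsGloballyMinimal] [NeZero (W.conductorNorm ℤ)],
      ¬ W.HasCM → (∀ n : ℕ, W.HasSurjectiveModNGaloisRep ((2 ^ n : ℕ) : ℤ)) → Odd W.torsionOrder → Odd W.tamagawaProduct →
      W.analyticRank = 1 →
      ∃ (K : Type) (_ : Field K) (_ : NumberField K), IsImaginaryQuadratic K ∧ Odd (NumberField.discr K) ∧
        NumberField.discr K ≠ -3 ∧ SatisfiesHeegnerHypothesis (W.conductorNorm ℤ) K ∧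
        ¬ IsSquare ((NumberField.discr K : ℚ) * -|W.Δ|) ∧ ¬ IsSquare ((NumberField.discr K : ℚ) * (-(2 * |W.Δ|))) ∧
        ∃ (Dt : ModularParametrizationData W (W.conductorNorm ℤ)) (β : ℤ) (ι : K →+* ℂ) (d₁ : KolyvaginHeegnerData Dt β ι 1),
          Odd Dt.c ∧ ¬ IsOfFinAddOrder d₁.derivedPoint ∧
          ∃ M₀ : ℕ, (∃ Q : (W.baseChange (ringClassField K ι 1)).toAffine.Point, ((2 ^ M₀ : ℕ) : ℤ) • Q = d₁.derivedPoint) ∧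
            (¬ ∃ Q : (W.baseChange (ringClassField K ι 1)).toAffine.Point, ((2 ^ (M₀ + 1) : ℕ) : ℤ) • Q = d₁.derivedPoint) ∧
            ∃ (n : ℕ) (d : KolyvaginHeegnerData Dt β ι n), Squarefree n ∧
              (∀ ℓ ∈ n.primeFactors, Zhang2014.IsKolyvaginPrime (W.conductorNorm ℤ) W K 2 ℓ) ∧
              ¬ ∃ Q : (W.baseChange (ringClassField K ι n)).toAffine.Point, (2 : ℤ) • Q = d.derivedPoint)
    (hZ : S_rankZeroTwin) : RankOneAtTwoBigImageOddLocal := by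
  intro W _ _ hCM hsurj hT hc hr
  haveI hN : NeZero (W.conductorNorm ℤ) := ⟨(W.conductorNorm_pos_holds).ne'⟩
  obtain ⟨K, _iF, _iN, hK, hodd, h3, hH, hsq1, hsq2, Dt, β, ι, d₁, hcM, hy, M₀, hdiv, hndiv, n, d, hn, hKoly, hPn⟩ :=
    hSup W hCM hsurj hT hc hr
  exact bsdp_two_of_kolyvaginExactAtTwo_at hGZ hGZK hmod hMilneC hX hZ W hCM hsurj hc hr K hK hodd h3 hH hsq1 hsq2 Dt hcM β ι
    d₁ hy M₀ hdiv hndiv n d hn hKoly hPn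

end Summit.BirchSwinnertonDyer.BirchSwinnertonDyer.Theorems.RankOneAtTwoOneDoor

end
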